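import Summits.QuantumFields.YangMills.Theorems.UnitScaleGibbsThinRectStub
import Summits.QuantumFields.YangMills.Theorems.UnitScaleGibbsAveragedPlaquetteLawSymmetry
import Literature.MathematicalPhysics.QuantumFieldTheory.Balaban1983to89.T4AxialGaugeSmallField
import HarnessLib

/-!
# LINE 28 «GrossTransfer» (crux stmt-QuantumFields-23083 `RevelationMartingale.MeanDeviationL`), skeleton v3.2 — RE-STAMP of the two
# registry rows that are ALREADY INHABITED in the tree: `stub_thinRect` and `stub_orient` (S-task named by ideator ym-r3-idea-2 g17,
# 2026-08-29T22:50Z; seat ym-line-cst-p1 g34)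

The registered skeleton `Summits/QuantumFields/YangMills/Cruxes/HistoryTailL/Lines/gross_transfer.lean` v3.2 (sha16 d4f482c26c4d4c70,
`ledger skeleton check --crux stmt-QuantumFields-23083` 22:46:33Z) carries, among its active `stub_*` rows, two whose texts are theorems of the
tree under other names.  This definition-free file states each row with its REGISTERED SIGNATURE VERBATIM and proves it BY NAME:

* `stub_thinRect` (the perimeter-law second moment of axial-gauge-dressed box bonds, `∫ dist₁((U^{axialGauge U lo hi}) b)² dμ_K ≤ C·n·β_K⁻¹`)
  := ✓ `UnitScaleGibbsThinRectStub.stub_thinRect_holds'` (p746963; px5 g10 (THIN-RECT) lane: comb-ladder dictionary + RP log-convexity of thin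
  Wilson rectangles + the finest-scale plaquette second moment);
* `stub_orient` (the law of `dist₁(Ū^j(∂p))` under `gibbsK` does not depend on the level-`j` plaquette `p`)
  := ✓ `UnitScaleGibbsAveragedPlaquetteLawSymmetry.gibbsK_integral_dist1_iterPlaq_eq` (w3-19936 g18 (ORIENT): hypercubic symmetry of the
  Wilson–Gibbs law + equivariance of the (0.4) averaging tower), binder order rearranged.

HONEST SCOPE.  Bookkeeping: a re-stamp proves nothing new.  The line's open rows `stub_linTest` (the identification, L) and
`stub_meanDeviationDeep` (= stmt-QuantumFields-23134, XL) are untouched; nothing of 23083, 23133, 23134, `HistoryTailL` (19936) or the rung R3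
is proved.  R3 = continuum SU(2) Yang–Mills on the three-torus — NOT d = 4, NOT infinite volume, NOT a mass gap, NOT the Clay problem.

References: T. Bałaban, Commun. Math. Phys. 102 (1985) 255–275 [Balaban1985UV3] ((1)–(3) p.256, (7) p.257); Commun. Math. Phys. 98 (1985)
17–51 [Balaban1985Averaging] (pp. 24–25); E. Seiler, LNP 159 (1982) §2.
-/

set_option autoImplicit false

noncomputable section

namespace Summit.QuantumFields.YangMills.Theorems.GrossTransferStubsRestampV32

open MeasureTheory
open scoped BigOperators Matrix.Norms.Frobenius
open Literature.MathematicalPhysics.QuantumFieldTheory.Balaban1983to89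
open Literature.MathematicalPhysics.QuantumFieldTheory.Balaban1983to89.T3ContinuumYM3Torus
open Literature.MathematicalPhysics.QuantumFieldTheory.Balaban1983to89.T3UnitScaleTilt
open Literature.MathematicalPhysics.QuantumFieldTheory.Balaban1983to89.T3UnitLawDensityEML (ℰp)
open Literature.MathematicalPhysics.QuantumFieldTheory.Balaban1983to89.T4AxialGaugeSmallField (axialGauge boxPlaqs boxBonds castSite)

/-- **`stub_thinRect` — THE PERIMETER-LAW SECOND MOMENT OF DRESSED BONDS** (registered text of skeleton v3.2, verbatim): for every `L` there are
`C ≥ 0` and `γ₁ ∈ (0,1]` such that for every family `F` with `F.L = L`, every `0 < γ ≤ γ₁`, every cut-off `K`, every non-wrapping box `[lo,hi]`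
of side `n` with `2n + 6 ≤ sitesPerDir 0` and every box bond `b`,
`∫ dist₁((U^{axialGauge U lo hi}) b)² d(gibbsK F ℰp γ K) ≤ C·n·(γ·L^{−K})`.  BY NAME: `UnitScaleGibbsThinRectStub.stub_thinRect_holds'`.
[cite: Balaban1985Averaging, pp. 24-25; Balaban1985UV3, (7) p.257] -/
theorem stub_thinRect :
    ∀ (L : ℕ), ∃ C : ℝ, 0 ≤ C ∧ ∃ γ₁ : ℝ, 0 < γ₁ ∧ γ₁ ≤ 1 ∧
        ∀ (F : T3Family) (γ : ℝ), F.L = L → 0 < γ → γ ≤ γ₁ → ∀ (K : ℕ) (lo hi : Fin (F.P K).d → ℤ) (n : ℕ),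
          (∀ κ, lo κ ≤ hi κ ∧ hi κ ≤ lo κ + n) → 2 * n + 6 ≤ (F.P K).sitesPerDir 0 →
          ∀ b : PBond (F.P K) 0, b ∈ (boxBonds lo hi : Set (PBond (F.P K) 0)) →
            ∫ U, (GaugeGroup.dist1 (GaugeField.gaugeAct (axialGauge U lo hi) U b)) ^ 2 ∂(gibbsK F ℰp γ K)
              ≤ C * n * (γ * ((L : ℝ)⁻¹) ^ K) :=
  UnitScaleGibbsThinRectStub.stub_thinRect_holds'

/-- **`stub_orient` — THE LAW OF `dist₁(Ū^j(∂p))` UNDER `gibbsK` DOES NOT DEPEND ON THE PLAQUETTE** (registered text of skeleton v3.2, verbatim):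
for every family `F`, every `γ ≥ 0`, all `K j`, any two level-`j` plaquettes `p q` and every `φ : ℝ → ℝ`,
`∫ φ(dist₁(Ū^j(∂p))) d(gibbsK F ℰp γ K) = ∫ φ(dist₁(Ū^j(∂q))) d(gibbsK F ℰp γ K)`.
BY NAME: `UnitScaleGibbsAveragedPlaquetteLawSymmetry.gibbsK_integral_dist1_iterPlaq_eq` (binders reordered). [cite: Balaban1985UV3, (1)-(3) p.256] -/
theorem stub_orient :
    ∀ (F : T3Family) (γ : ℝ), 0 ≤ γ → ∀ (K j : ℕ) (p q : Plaq (F.P K) j) (φ : ℝ → ℝ),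
      ∫ U, φ (GaugeGroup.dist1 (GaugeField.plaqHol (Averaging.iter (fun i' => BlockAveraging.blockAvg (P := F.P K) (j := i') ℰp) j U) p))
          ∂(gibbsK F ℰp γ K) =
        ∫ U, φ (GaugeGroup.dist1 (GaugeField.plaqHol (Averaging.iter (fun i' => BlockAveraging.blockAvg (P := F.P K) (j := i') ℰp) j U) q))
          ∂(gibbsK F ℰp γ K) :=
  fun F _γ hγ K _j p q φ =>
    UnitScaleGibbsAveragedPlaquetteLawSymmetry.gibbsK_integral_dist1_iterPlaq_eq F ℰp hγ K p q φ

end Summit.QuantumFields.YangMills.Theorems.GrossTransferStubsRestampV32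

end
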